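import Summits.QuantumFields.YangMills.Theorems.BalabanUVNodesN15KingModelConstraintCellOscillation
import HarnessLib

/-!
# N15 (NE2), King-model rung — THE CONSTRAINT TERM `T = a_K·Q*Q·A₀⁻¹`, part 3∕3: ★ ITS UNIFORM LETTERS IN dag-n15-a III-B's 1-FORM CURRENCY — PLAIN (coarse, fine)
# `T ⊗ 1 ≤ β·e^{−δ|y−y′|}` AND η-DEFECT `𝔇_{kingPrV}(T′ ⊗ 1, T̄ ⊗ 1) ≤ β·(L^K)^{−γ∕2}·e^{−δ|y−y′|}`, AT ONE `(β, δ)` — the second (and last) King-rung input of the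
# entry-3 knit «K-D» (dag-n15-a g25 I.42614) after part 2's ★★ cell-oscillation row

WHY ∕ WHERE (cell `pub-ymgap`, seat `pub-ymgap-dag-n15-d`, R134 N15 NE2 s3 «King-model rung», generation 21; ARCHITECTURE NOTE INBOX l.42576).  The covariant
fourth (3.42) entry of the first-order dressed King jet is `N²Δ_V X = m²X + T(1 + VX) − 1` (part 1); its η-defect needs, besides the jet defects (K-B) and the
sandwiched cell-oscillation rows (part 2 ★★), the PLAIN block majorants of `T̄ ⊗ 1` (coarse) and `T′ ⊗ 1` (fine) and the η-DEFECT `𝔇(T′ ⊗ 1, T̄ ⊗ 1)`.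
HOW.  PLAIN: `T ⊗ 1 = a_K·(Q*Q ⊗ 1)∘(A₀⁻¹ ⊗ 1)` with `Q*Q ⊗ 1 ≤ 𝟙[y = y′]` (part 2 `hasMaj_tensorId_blockMean`), K-A's plain letters of `A₀⁻¹ ⊗ 1`, `a_K ≤ a`
(`King1986.aK_le`).  DEFECT: part 2 `tensorId_constraint_eq` on both grids gives `T ⊗ 1 = 1 + (N²ΔA₀⁻¹) ⊗ 1 − m²(A₀⁻¹ ⊗ 1)`, so (`idef_add∕sub∕smul`, `𝔇(1,1) = 0`)
`𝔇(T′ ⊗ 1, T̄ ⊗ 1) = 𝔇(N′²Δ′A₀′⁻¹ ⊗ 1, N²ΔA₀⁻¹ ⊗ 1) − m²·𝔇(A₀′⁻¹ ⊗ 1, A₀⁻¹ ⊗ 1)` — K-A `hasMaj_idef_tensorId_kingLapOp` ∕ `hasMaj_idef_tensorId_kingGOp` (King's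
(3.71)∕(3.73) summed over (2.17) = n15-e P″∕Q4b through Σ-a), `m² ≤ m₀²`.
WHAT (0 `sorry`, 0 `def`, standard axioms; ns `Summit.QuantumFields.YangMills.BalabanUVNodes.N15.KingModel.Constraint`): ★ `kingQOp_uniform_letters`.
HONEST FRAMING ∕ LIMITS.  Count-neutral bookkeeping on King's `A = 0` MODEL (template literature — [King1986] (2.13)–(2.17) p. 653, (4.1)–(4.5) p. 670, (4.36)
p. 674, Prop. 3.8 (3.71) p. 664, Prop. 3.9 (3.73) p. 665, p. 664 (pairing)), NOT Bałaban's covariant `G(U)`; [Balaban1985BackgroundPropagators] Thm 3.1 (3.42)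
p. 397 cited as SHAPE only; the entry-3 knit (K-D) is dag-n15-a's, not here.  NE2⁺ NOT PRINTED ∕ NOT proved; N15 NOT discharged; K3⁸ OPEN; counts UNMOVED (typed
28∕28 · discharged 5∕27 · A 5∕28); one finite torus at fixed spacings — NOT ℝ⁴ ∕ OS ∕ mass gap ∕ Clay.  `--kind proof --supports stmt-QuantumFields-27366 --as helper`.
-/

noncomputable section

open scoped BigOperators
open Finset Matrix

namespace Summit.QuantumFields.YangMills.BalabanUVNodes.N15.KingModel.Constraint

open Literature.MathematicalPhysics.QuantumFieldTheory.Balaban1983to89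
open Literature.MathematicalPhysics.QuantumFieldTheory.Balaban1983to89.B11SectG (BlockNorm HasMaj hasMaj_comp)
open Literature.MathematicalPhysics.QuantumFieldTheory.Balaban1983to89.T4EtaRateDefect (idef idef_apply idef_add idef_sub idef_smul)
open Literature.MathematicalPhysics.QuantumFieldTheory.Balaban1983to89.T4EtaRateCoeffDefect (pull pull_apply)
open Literature.MathematicalPhysics.QuantumFieldTheory.Balaban1983to89.B5Prop11Plancherel (Tor fine)
open Literature.MathematicalPhysics.QuantumFieldTheory.King1986 (aK aK_pos aK_le)
open Literature.MathematicalPhysics.QuantumFieldTheory.King1986.Torus (blockOf blockProj tdistT tdistT_nonneg)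
open Literature.MathematicalPhysics.QuantumFieldTheory.Balaban1983to89.B6UnitTorusCarrier (unitTorusGeo)
open Summit.QuantumFields.YangMills.BalabanUVNodes.N15.VectorPiece (kingPrV blkFine tensorId tensorId_apply)
open Summit.QuantumFields.YangMills.BalabanUVNodes.N15.TwoGrid.KingJet (hasMaj_tensorId_kingGOp_coarse hasMaj_tensorId_kingGOp_fine hasMaj_idef_tensorId_kingGOp
  hasMaj_idef_tensorId_kingLapOp)
open Summit.QuantumFields.YangMills.BalabanUVNodes.N15KingModelRung.Curved (kingGOp kingLapOp)

variable {d : ℕ} (L : ℕ) [NeZero L]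

/-! ## ★ The uniform letters of the constraint term: plain (coarse, fine) and η-defect, at one `(β, δ)` -/

section Letters

variable (d)

/-- ★ **THE UNIFORM LETTERS OF `T = a_K·Q*Q·A₀⁻¹ ⊗ 1`** in III-B's 1-form currency: for odd `L ≥ 3`, `a > 0`, `m₀² ≥ 0`, `0 ≤ γ < 1` there are `β, δ > 0` such
that for every `K ≥ 1`, `n ≥ 1`, cube `2L^e`, mass `0 < m² ≤ m₀²`: PLAIN coarse `T̄ ⊗ 1 ≤ β·e^{−δ|y−y′|}` (blocks `blkFine`), PLAIN fine `T′ ⊗ 1 ≤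
β·e^{−δ|y−y′|}` (fine unit blocks) — both as `a_K·(Q*Q ⊗ 1)∘(A₀⁻¹ ⊗ 1)` with `Q*Q ⊗ 1 ≤ 𝟙`, `a_K ≤ a` (`King1986.aK_le`), K-A's plain letters —, and the
η-DEFECT `𝔇_{kingPrV}(T′ ⊗ 1, T̄ ⊗ 1) ≤ β·(L^K)^{−γ∕2}·e^{−δ|y−y′|}` — by §1 `T ⊗ 1 = 1 + (N²ΔA₀⁻¹) ⊗ 1 − m²(A₀⁻¹ ⊗ 1)` on both grids the defect is
`𝔇(N′²Δ′A₀′⁻¹ ⊗ 1, N²ΔA₀⁻¹ ⊗ 1) − m²·𝔇(A₀′⁻¹ ⊗ 1, A₀⁻¹ ⊗ 1)` (`𝔇(1,1) = 0`; K-A `hasMaj_idef_tensorId_kingLapOp`, `hasMaj_idef_tensorId_kingGOp` = King's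
(3.71)∕(3.73) summed over (2.17)). [cite: King1986, (4.1)–(4.5) p.670, (4.36) p.674, (2.13)–(2.17) p.653, Prop. 3.8 (3.71) p.664, Prop. 3.9 (3.73) p.665, p.664 (pairing); Balaban1985BackgroundPropagators, Thm 3.1 (3.42) p.397 (fourth entry: shape)] -/
theorem kingQOp_uniform_letters (hLodd : Odd L) (hL : 2 ≤ L) {a : ℝ} (ha : 0 < a) {m0sq : ℝ} (hm0 : 0 ≤ m0sq) {γ : ℝ} (hγ0 : 0 ≤ γ) (hγ1 : γ < 1) :
    ∃ β δ : ℝ, 0 < β ∧ 0 < δ ∧ ∀ (K : ℕ), 1 ≤ K → ∀ (n : ℕ), 1 ≤ n → ∀ (e : ℕ) (M : Fin (d + 1) → ℕ) [∀ μ, NeZero (M μ)], (∀ μ, M μ = 2 * L ^ e) →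
      ∀ (msq : ℝ), 0 < msq → msq ≤ m0sq →
      HasMaj (BlockNorm.ofBlocks (unitTorusGeo L K M) (blkFine L K M)) (BlockNorm.ofBlocks (unitTorusGeo L K M) (blkFine L K M))
          (tensorId (Fin (d + 1)) (aK a L K • (Matrix.mulVecLin (blockProj (L ^ K) M) ∘ₗ kingGOp L a msq K (L ^ K) M)))
          (fun y y' => β * Real.exp (-(δ * tdistT M y y'))) ∧
      HasMaj (BlockNorm.ofBlocks (unitTorusGeo L K M) (fun i : Tor (fine (L ^ n * L ^ K) M) × Fin (d + 1) => blockOf (L ^ n * L ^ K) M i.1))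
          (BlockNorm.ofBlocks (unitTorusGeo L K M) (fun i : Tor (fine (L ^ n * L ^ K) M) × Fin (d + 1) => blockOf (L ^ n * L ^ K) M i.1))
          (tensorId (Fin (d + 1)) (aK a L (K + n) • (Matrix.mulVecLin (blockProj (L ^ n * L ^ K) M) ∘ₗ kingGOp L a msq (K + n) (L ^ n * L ^ K) M)))
          (fun y y' => β * Real.exp (-(δ * tdistT M y y'))) ∧
      HasMaj (BlockNorm.ofBlocks (unitTorusGeo L K M) (blkFine L K M))
          (BlockNorm.ofBlocks (unitTorusGeo L K M) (fun i : Tor (fine (L ^ n * L ^ K) M) × Fin (d + 1) => blockOf (L ^ n * L ^ K) M i.1))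
          (idef (pull (kingPrV L K n M)) (pull (kingPrV L K n M))
            (tensorId (Fin (d + 1)) (aK a L (K + n) • (Matrix.mulVecLin (blockProj (L ^ n * L ^ K) M) ∘ₗ kingGOp L a msq (K + n) (L ^ n * L ^ K) M)))
            (tensorId (Fin (d + 1)) (aK a L K • (Matrix.mulVecLin (blockProj (L ^ K) M) ∘ₗ kingGOp L a msq K (L ^ K) M))))
          (fun y y' => β * ((L : ℝ) ^ K) ^ (-(γ / 2)) * Real.exp (-(δ * tdistT M y y'))) := by
  obtain ⟨β₁, δ₁, hβ₁, hδ₁, H₁⟩ := hasMaj_tensorId_kingGOp_coarse (d := d) L hLodd hL ha hm0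
  obtain ⟨β₂, δ₂, hβ₂, hδ₂, H₂⟩ := hasMaj_tensorId_kingGOp_fine (d := d) L hLodd hL ha hm0
  obtain ⟨β₃, δ₃, hβ₃, hδ₃, H₃⟩ := hasMaj_idef_tensorId_kingLapOp (d := d) L hLodd hL ha hm0 hγ0 hγ1
  obtain ⟨β₄, δ₄, hβ₄, hδ₄, H₄⟩ := hasMaj_idef_tensorId_kingGOp (d := d) L hLodd hL ha hm0 hγ0 hγ1
  set δ : ℝ := min (min δ₁ δ₂) (min δ₃ δ₄) with hδ_def
  have hδ : 0 < δ := lt_min (lt_min hδ₁ hδ₂) (lt_min hδ₃ hδ₄)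
  have hle₁ : δ ≤ δ₁ := (min_le_left _ _).trans (min_le_left _ _)
  have hle₂ : δ ≤ δ₂ := (min_le_left _ _).trans (min_le_right _ _)
  have hle₃ : δ ≤ δ₃ := (min_le_right _ _).trans (min_le_left _ _)
  have hle₄ : δ ≤ δ₄ := (min_le_right _ _).trans (min_le_right _ _)
  set β : ℝ := a * β₁ + a * β₂ + β₃ + m0sq * β₄ + 1 with hβ_def
  have hβ : 0 < β := by positivity
  have hL1 : (1 : ℝ) < (L : ℝ) := by exact_mod_cast (show 1 < L by omega)
  refine ⟨β, δ, hβ, hδ, fun K hK n hn e M _ hM msq hmsq hcap => ⟨?_, ?_, ?_⟩⟩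
  · -- PLAIN, coarse: `a_K·(Q*Q ⊗ 1)∘(A₀⁻¹ ⊗ 1)`
    have hG := H₁ K hK e M hM msq hmsq hcap
    have hQ : HasMaj (BlockNorm.ofBlocks (unitTorusGeo L K M) (blkFine L K M)) (BlockNorm.ofBlocks (unitTorusGeo L K M) (blkFine L K M))
        (tensorId (Fin (d + 1)) (Matrix.mulVecLin (blockProj (L ^ K) M))) (fun y y' => if y = y' then 1 else 0) :=
      hasMaj_tensorId_blockMean L M K (L ^ K)
    have haK : 0 ≤ aK a (L : ℝ) K := (aK_pos ha hL1 hK).le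
    have haKle : aK a (L : ℝ) K ≤ a := aK_le ha hL1 hK
    have hi : ∀ y y' : Tor M, 0 ≤ (if y = y' then (1 : ℝ) else 0) := fun y y' => by split_ifs <;> norm_num
    have hcomp := hasMaj_comp hQ hG hi
    have hκ : (BlockNorm.ofBlocks (unitTorusGeo L K M) (blkFine L K M)).κ = 1 := rfl
    have hcomp' : HasMaj (BlockNorm.ofBlocks (unitTorusGeo L K M) (blkFine L K M)) (BlockNorm.ofBlocks (unitTorusGeo L K M) (blkFine L K M))
        (tensorId (Fin (d + 1)) (Matrix.mulVecLin (blockProj (L ^ K) M)) ∘ₗ tensorId (Fin (d + 1)) (kingGOp L a msq K (L ^ K) M))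
        (fun y y' => β₁ * Real.exp (-(δ₁ * tdistT M y y'))) := by
      refine hcomp.mono fun y y' => le_of_eq ?_
      rw [hκ]
      simp only [ite_mul, one_mul, zero_mul, Finset.sum_ite_eq, Finset.mem_univ, if_true]
    rw [tensorId_smul_eq, ← tensorId_comp_eq]
    refine (hasMaj_smul_ofBlocks L M hcomp' haK).mono fun y y' => ?_
    have hE : Real.exp (-(δ₁ * tdistT M y y')) ≤ Real.exp (-(δ * tdistT M y y')) := Real.exp_le_exp.mpr (by nlinarith [tdistT_nonneg M y y'])
    have hE0 : 0 ≤ Real.exp (-(δ * tdistT M y y')) := Real.exp_nonneg _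
    have h1 : aK a (L : ℝ) K * (β₁ * Real.exp (-(δ₁ * tdistT M y y'))) ≤ a * β₁ * Real.exp (-(δ * tdistT M y y')) := by
      calc aK a (L : ℝ) K * (β₁ * Real.exp (-(δ₁ * tdistT M y y'))) ≤ a * (β₁ * Real.exp (-(δ * tdistT M y y'))) :=
            mul_le_mul haKle (mul_le_mul_of_nonneg_left hE hβ₁.le) (by positivity) ha.le
        _ = a * β₁ * Real.exp (-(δ * tdistT M y y')) := by ring
    have h2 : a * β₁ * Real.exp (-(δ * tdistT M y y')) ≤ β * Real.exp (-(δ * tdistT M y y')) :=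
      mul_le_mul_of_nonneg_right (by rw [hβ_def]; nlinarith [mul_pos ha hβ₂, hβ₃, mul_nonneg hm0 hβ₄.le]) hE0
    exact h1.trans h2
  · -- PLAIN, fine
    have hG := H₂ K hK n e M hM msq hmsq hcap
    have hQ := hasMaj_tensorId_blockMean L M K (L ^ n * L ^ K)
    have hKn : 1 ≤ K + n := by omega
    have haK : 0 ≤ aK a (L : ℝ) (K + n) := (aK_pos ha hL1 hKn).le
    have haKle : aK a (L : ℝ) (K + n) ≤ a := aK_le ha hL1 hKn
    have hi : ∀ y y' : Tor M, 0 ≤ (if y = y' then (1 : ℝ) else 0) := fun y y' => by split_ifs <;> norm_num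
    have hcomp := hasMaj_comp hQ hG hi
    have hκ : (BlockNorm.ofBlocks (unitTorusGeo L K M) (fun i : Tor (fine (L ^ n * L ^ K) M) × Fin (d + 1) => blockOf (L ^ n * L ^ K) M i.1)).κ = 1 := rfl
    have hcomp' : HasMaj (BlockNorm.ofBlocks (unitTorusGeo L K M) (fun i : Tor (fine (L ^ n * L ^ K) M) × Fin (d + 1) => blockOf (L ^ n * L ^ K) M i.1))
        (BlockNorm.ofBlocks (unitTorusGeo L K M) (fun i : Tor (fine (L ^ n * L ^ K) M) × Fin (d + 1) => blockOf (L ^ n * L ^ K) M i.1))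
        (tensorId (Fin (d + 1)) (Matrix.mulVecLin (blockProj (L ^ n * L ^ K) M)) ∘ₗ tensorId (Fin (d + 1)) (kingGOp L a msq (K + n) (L ^ n * L ^ K) M))
        (fun y y' => β₂ * Real.exp (-(δ₂ * tdistT M y y'))) := by
      refine hcomp.mono fun y y' => le_of_eq ?_
      rw [hκ]
      simp only [ite_mul, one_mul, zero_mul, Finset.sum_ite_eq, Finset.mem_univ, if_true]
    rw [tensorId_smul_eq, ← tensorId_comp_eq]
    refine (hasMaj_smul_ofBlocks L M hcomp' haK).mono fun y y' => ?_
    have hE : Real.exp (-(δ₂ * tdistT M y y')) ≤ Real.exp (-(δ * tdistT M y y')) := Real.exp_le_exp.mpr (by nlinarith [tdistT_nonneg M y y'])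
    have hE0 : 0 ≤ Real.exp (-(δ * tdistT M y y')) := Real.exp_nonneg _
    have h1 : aK a (L : ℝ) (K + n) * (β₂ * Real.exp (-(δ₂ * tdistT M y y'))) ≤ a * β₂ * Real.exp (-(δ * tdistT M y y')) := by
      calc aK a (L : ℝ) (K + n) * (β₂ * Real.exp (-(δ₂ * tdistT M y y'))) ≤ a * (β₂ * Real.exp (-(δ * tdistT M y y'))) :=
            mul_le_mul haKle (mul_le_mul_of_nonneg_left hE hβ₂.le) (by positivity) ha.le
        _ = a * β₂ * Real.exp (-(δ * tdistT M y y')) := by ring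
    have h2 : a * β₂ * Real.exp (-(δ * tdistT M y y')) ≤ β * Real.exp (-(δ * tdistT M y y')) :=
      mul_le_mul_of_nonneg_right (by rw [hβ_def]; nlinarith [mul_pos ha hβ₁, hβ₃, mul_nonneg hm0 hβ₄.le]) hE0
    exact h1.trans h2
  · -- η-DEFECT through the identity on both grids
    have hKn : 1 ≤ K + n := by omega
    rw [tensorId_constraint_eq L M hL ha hKn hmsq, tensorId_constraint_eq L M hL ha hK hmsq, idef_sub, idef_add, idef_smul]
    have hid : idef (pull (kingPrV L K n M)) (pull (kingPrV L K n M)) (LinearMap.id : (Tor (fine (L ^ n * L ^ K) M) × Fin (d + 1) → ℝ) →ₗ[ℝ] _)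
        (LinearMap.id : (Tor (fine (L ^ K) M) × Fin (d + 1) → ℝ) →ₗ[ℝ] _) = 0 := by
      refine LinearMap.ext fun g => ?_
      rw [idef_apply, LinearMap.id_apply, LinearMap.id_apply, sub_self, LinearMap.zero_apply]
    rw [hid, zero_add]
    have hLap := H₃ K hK n hn e M hM msq hmsq hcap
    have hGd := H₄ K hK n hn e M hM msq hmsq hcap
    have hθ : 0 ≤ ((L : ℝ) ^ K) ^ (-(γ / 2)) := Real.rpow_nonneg (pow_nonneg (Nat.cast_nonneg _) _) _
    have hsm := hasMaj_smul_ofBlocks L M hGd hmsq.le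
    refine (hLap.sub hsm).mono fun y y' => ?_
    have hE₃ : Real.exp (-(δ₃ * tdistT M y y')) ≤ Real.exp (-(δ * tdistT M y y')) := Real.exp_le_exp.mpr (by nlinarith [tdistT_nonneg M y y'])
    have hE₄ : Real.exp (-(δ₄ * tdistT M y y')) ≤ Real.exp (-(δ * tdistT M y y')) := Real.exp_le_exp.mpr (by nlinarith [tdistT_nonneg M y y'])
    have hw : 0 ≤ ((L : ℝ) ^ K) ^ (-(γ / 2)) * Real.exp (-(δ * tdistT M y y')) := mul_nonneg hθ (Real.exp_nonneg _)
    have h3 : β₃ * ((L : ℝ) ^ K) ^ (-(γ / 2)) * Real.exp (-(δ₃ * tdistT M y y')) ≤ β₃ * (((L : ℝ) ^ K) ^ (-(γ / 2)) * Real.exp (-(δ * tdistT M y y'))) := by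
      rw [mul_assoc]; exact mul_le_mul_of_nonneg_left (mul_le_mul_of_nonneg_left hE₃ hθ) hβ₃.le
    have h4 : msq * (β₄ * ((L : ℝ) ^ K) ^ (-(γ / 2)) * Real.exp (-(δ₄ * tdistT M y y')))
        ≤ m0sq * β₄ * (((L : ℝ) ^ K) ^ (-(γ / 2)) * Real.exp (-(δ * tdistT M y y'))) := by
      calc msq * (β₄ * ((L : ℝ) ^ K) ^ (-(γ / 2)) * Real.exp (-(δ₄ * tdistT M y y')))
          = msq * (β₄ * (((L : ℝ) ^ K) ^ (-(γ / 2)) * Real.exp (-(δ₄ * tdistT M y y')))) := by ring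
        _ ≤ m0sq * (β₄ * (((L : ℝ) ^ K) ^ (-(γ / 2)) * Real.exp (-(δ * tdistT M y y')))) :=
            mul_le_mul hcap (mul_le_mul_of_nonneg_left (mul_le_mul_of_nonneg_left hE₄ hθ) hβ₄.le) (by positivity) hm0
        _ = m0sq * β₄ * (((L : ℝ) ^ K) ^ (-(γ / 2)) * Real.exp (-(δ * tdistT M y y'))) := by ring
    have hrest : 0 ≤ (a * β₁ + a * β₂ + 1) * (((L : ℝ) ^ K) ^ (-(γ / 2)) * Real.exp (-(δ * tdistT M y y'))) := by positivity
    calc β₃ * ((L : ℝ) ^ K) ^ (-(γ / 2)) * Real.exp (-(δ₃ * tdistT M y y')) + msq * (β₄ * ((L : ℝ) ^ K) ^ (-(γ / 2)) * Real.exp (-(δ₄ * tdistT M y y')))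
        ≤ β₃ * (((L : ℝ) ^ K) ^ (-(γ / 2)) * Real.exp (-(δ * tdistT M y y'))) + m0sq * β₄ * (((L : ℝ) ^ K) ^ (-(γ / 2)) * Real.exp (-(δ * tdistT M y y')))
          + (a * β₁ + a * β₂ + 1) * (((L : ℝ) ^ K) ^ (-(γ / 2)) * Real.exp (-(δ * tdistT M y y'))) := by linarith
      _ = β * ((L : ℝ) ^ K) ^ (-(γ / 2)) * Real.exp (-(δ * tdistT M y y')) := by rw [hβ_def]; ring

end Letters

end Summit.QuantumFields.YangMills.BalabanUVNodes.N15.KingModel.Constraint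

end
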